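import Summits.QuantumFields.YangMills.Theorems.TwistedTraceScaling.Negative.StiffGapSlowDominance
import Summits.QuantumFields.YangMills.Theorems.LuscherReductionTwistedTraceScalingBTProfileRecord
import HarnessLib

/-!
# R42 — PROFILE DOMINANCE NECESSITY for the stiff brick (B-ST), for EVERY profile of record `(Ω, σ)`, and its discharge by lane A's schedule-B (B-T):
# (B-ST) with gap `θ₀` for `(Ω, σ)` is refuted by any ADMISSIBLE fibre profile eventually disjoint from `Ω` whose schedule-B slow factor is `≥ σ`
# (crux `TwistedTraceScaling` stmt-QuantumFields-20203, skeleton «twolattice», S-BASE C4-CORE; standing disprover, cycle 34b; sequel of R41 `…Negative.StiffGapSlowDominance`)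

R41 proved the necessity for the specific pair `(btOmega, btSlow)` of `…BTRecord`.  Lane A has since landed `…BTProfileRecord.profileB_hT` — the two-sided tube brick (B-T)
for EVERY admissible profile family `Ω'` (measurable, `0 ≤ Ω' ≤ 1`, colour blind, supported in fibre radius `r' β ≤ min(1/40, β^{-1/2}ℓ)`, `γ > 0`; `ℓ = btLog β`) with the
schedule-B slow factor `σ_B(Ω') β = btC L β (Ω' β) (btEps β) (5β^{-1/2}ℓ²)/fpZ (btEps β)/recordGamma L Ω' β` and rate `κ_B = 2β^{-2s}ℓ⁹` — and re-typed (B-ST)/(B-OD) as the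
hypotheses `hST`/`hOD` of `…BTProfileRecord.recordAnalyticInput_of_profile` for an arbitrary admissible `(Ω, σ_B(Ω))`.  This file:
* §1 ★★★ `profile_dominates_of_stiff_gap` — R41's necessity for an ARBITRARY pair `(Ω, σ)` (`σ ≥ 0` eventually; disjointness only eventually): (B-ST)`(Ω, σ, θ₀ ≤ 1, M ≥ 1)`
  and a one-sided-certified competitor `Ω'` (slow factor `σ'`, rate `κ' → 0`) eventually disjoint from `Ω` ⇒ `∀ ε > 0, ∀ᶠ β, (1 − ε)σ' ≤ (1 − θ₀)(1 + ε)σ`;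
  §2 `stiffGap_false_of_competitor` (`σ ≤ Dσ'`, `(1 − θ₀)D < 1` ⇒ ¬(B-ST)), `stiffGap_false_of_dominant_competitor` (`D = 1`).
* §3 ★★★ `stiffGap_false_of_admissible_competitor` — THE DISCHARGE OF THE CERTIFICATE: if `Ω'` is ADMISSIBLE in lane A's sense (the hypothesis list of `profileB_hT`, with
  `∫Ω' dπ > 0` eventually), eventually disjoint from `Ω`, and `σ β ≤ σ_B(Ω') β` eventually, then (B-ST)`(Ω, σ, θ₀, M)` is FALSE for every `θ₀ ∈ (0,1]`, `M ≥ 1`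
  (`0 < s < 1/5`, `L` with a nonzero site) — the (B-T) certificate of the competitor is lane A's own `profileB_hT`, its positivity `btC_profile_pos`, its radius
  `eventually_radius_small_B`, its rate `tendsto_powScale_mul_btLog_pow`.
* §4 the two packagings of record: ★★★ `btStiffGap_false_of_admissible_competitor` — `hST` of `…BTRecord.recordAnalyticInput_of_stiff_offDiag` (`Ω = btOmega`, flat on
  `‖x‖ ≤ min(1/40, β^{-1/2})`, `σ = btSlow`) is false as soon as ONE admissible profile supported in the annulus `β^{-1/2} < ‖x‖ ≤ β^{-1/2}ℓ` has `σ_B ≥ btSlow` eventually;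
  ★★★ `profileStiffGap_false_of_admissible_competitor` — the same for `hST` of `…BTProfileRecord.recordAnalyticInput_of_profile` (`(Ω, σ_B(Ω))` admissible).
READING.  (B-ST) is a VARIATIONAL EXTREMALITY CLAIM about the profile of record: its slow factor must beat — by the factor `1/(1 − θ₀)` — the schedule-B slow factor of every
admissible profile living off its support.  For a full-ball frozen profile `frozenProfile L q r_B` (support = the whole admissible ball) no admissible disjoint competitor
exists and §4(b) is void, as it should be; for `btOmega` (radius `β^{-1/2}`, no `log`) the annulus `β^{-1/2} < ‖x‖ ≤ β^{-1/2}ℓ` is free, and in the BO fibre model the Mehler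
ground amplitude restricted to it has quotient `≈ Λ_top` against `≤ 0.37·Λ_top` for any profile inside the unit ball at `L = 2` (R41, R40 docstrings; Annex B §V1k-d/§V1l):
the remaining construction target of this seat is now PURELY the comparison `btSlow ≤ σ_B(Ω')` for one explicit admissible annular profile `Ω'` — no (B-T) work is left in it.
HONEST FRAMING: necessity bookkeeping about a stub (S-BASE, C4-CORE) of a child of the CONDITIONAL reduction route R2b1; nothing here refutes a landed theorem (lane A's
theorems take (B-ST) as a hypothesis); not `¬TwistedTraceScaling`, not infinite volume, not a gap, not Clay.
-/

set_option autoImplicit false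

noncomputable section

open MeasureTheory Real Filter Topology
open scoped BigOperators
open Literature.MathematicalPhysics.QuantumFieldTheory hiding SU2
open Literature.MathematicalPhysics.QuantumLattice

namespace Summit.QuantumFields.YangMills.Theorems.TwistedTraceScaling.Negative.R42

open Summit.QuantumFields.YangMills.Theorems.FemtoTransferGap
open Summit.QuantumFields.YangMills.Theorems.FemtoTransferGap.TwoLattice
open Summit.QuantumFields.YangMills.Theorems.FemtoTransferGap.TwoLattice.Avg
open Summit.QuantumFields.YangMills.Theorems.FemtoTransferGap.TwoLattice.ConstTube
open Summit.QuantumFields.YangMills.Theorems.FemtoTransferGap.TwoLattice.Stiff (LinkSpace)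
open Summit.QuantumFields.YangMills.Theorems.FemtoTransferGap.TwoLattice.Cov
open Summit.QuantumFields.YangMills.Theorems.TwistedTraceScaling.Negative.R41

variable {L : ℕ} [NeZero L]

/-! ## §1 ★★★ The necessity for an arbitrary profile of record -/

/-- ★★★ **PROFILE DOMINANCE NECESSITY.**  `L` with a nonzero site, `0 < s < 1/5`; `(Ω, σ)` any profile/slow-factor pair with `σ ≥ 0` eventually; `Ω'` (radius `R'`, slow
factor `σ' > 0`, rate `κ' → 0`) a fibre profile family eventually DISJOINT from `Ω` with the one-sided (B-T) certificate on the window `{orbitDist < recordDelta1 L s β}`.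
If (B-ST) holds for `(Ω, σ)` with gap `θ₀ ≤ 1` at a fat factor `M ≥ 1`, then `∀ ε > 0`, eventually `(1 − ε)·σ' β ≤ (1 − θ₀)·(1 + ε)·σ β`.
[cite: Luscher1983, §3] [cite: SjostrandZworski2007, §2] -/
theorem profile_dominates_of_stiff_gap (hL : Nonempty (NzSite L)) {s : ℝ} (hs : 0 < s) (hs5 : s < 1 / 5)
    {Ω : ℝ → LinkSpace L → ℝ} {σ : ℝ → ℝ} (hσ : ∀ᶠ β in atTop, 0 ≤ σ β) {Ω' : ℝ → LinkSpace L → ℝ} {R' σ' κ' : ℝ → ℝ}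
    (hΩ'm : ∀ β, Measurable (Ω' β)) (hΩ'1 : ∀ β x, |Ω' β x| ≤ 1) (hΩ'r : ∀ β x, Ω' β x ≠ 0 → ‖x‖ ≤ R' β)
    (hR' : ∀ β, 0 ≤ R' β ∧ R' β ≤ 1 / 2) (hR'small : ∀ᶠ β in atTop, 12 * Fintype.card (Site 3 L) * R' β < powScale s β)
    (hdisj : ∀ᶠ β in atTop, ∀ x, Ω' β x ≠ 0 → Ω β x = 0)
    (hγ' : ∀ᶠ β in atTop, 0 < recordGamma L Ω' β) (hσ' : ∀ᶠ β in atTop, 0 < σ' β) (hκ' : Tendsto κ' atTop (𝓝 0))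
    (hT' : ∀ᶠ β in atTop, ∀ φ : GaugeConfig 3 1 SU2 → ℝ, Measurable φ → (∃ C : ℝ, ∀ u, |φ u| ≤ C) →
      (∀ (g : Site 3 1 → SU2) (u : GaugeConfig 3 1 SU2), φ (gaugeTransform g u) = φ u) → (∀ u, φ u ≠ 0 → orbitDist u < recordDelta1 L s β) →
      σ' β * recordGamma L Ω' β * qform su2Rep ((L : ℝ) ^ 3 * β) φ φ
        - κ' β * (σ' β * recordGamma L Ω' β) * (qform su2Rep ((L : ℝ) ^ 3 * β) φ φ + levelValue su2Rep 1 ((L : ℝ) ^ 3 * β) 0 * l2 φ φ)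
        ≤ tubeForm β (boFun L φ (Ω' β)))
    {M : ℝ} (hM : 1 ≤ M) {θ₀ : ℝ} (hθ₀ : θ₀ ≤ 1)
    (hST : ∀ᶠ β in atTop, ∀ v : GaugeConfig 3 L SU2 → ℝ, Measurable v → (∃ C : ℝ, ∀ U, |v U| ≤ C) → (∀ U, v U ≠ 0 → recordChi L s 43 M β U ≠ 0) →
      (∀ u, fibreInner L (softWeight (recordChi L s 43 M β)) (Ω β) v u = 0) →
      tubeForm β v ≤ (1 - θ₀) * (σ β * levelValue su2Rep 1 ((L : ℝ) ^ 3 * β) 0) * tubeNormSq (softWeight (recordChi L s 43 M β)) v) :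
    ∀ ε : ℝ, 0 < ε → ∀ᶠ β in atTop, (1 - ε) * σ' β ≤ (1 - θ₀) * (1 + ε) * σ β := by
  intro ε hε
  -- WLOG `ε ≤ 1`
  set ε₁ : ℝ := min ε 1 with hε₁def
  have hε₁ : 0 < ε₁ := lt_min hε one_pos
  have hε₁1 : ε₁ ≤ 1 := min_le_right _ _
  have hε₁ε : ε₁ ≤ ε := min_le_left _ _
  have hε4 : ε₁ / 4 ≤ 1 := by linarith only [hε₁1]
  have hε2 : 0 ≤ ε₁ / 2 := by linarith only [hε₁]
  -- (P), upper half, at the fat factor `M`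
  obtain ⟨C, hC, hP⟩ := gaugeAvg_recordChi_le hL hs (by linarith only [hs5]) M
  -- the near-top one-site amplitude at slack `ε₁/2`
  obtain ⟨B₀, hB₀⟩ := exists_localized_near_top (ε₁ / 2) (by linarith only [hε₁])
  -- the rates
  have hκN : Tendsto (fun β => C * (43 * powScale s β) ^ 2) atTop (𝓝 0) := by
    have := (((tendsto_powScale hs).const_mul 43).pow 2).const_mul C; simpa using this
  have hL1 : (1 : ℝ) ≤ (L : ℝ) := by exact_mod_cast NeZero.one_le
  have hL3 : (1 : ℝ) ≤ (L : ℝ) ^ 3 := one_le_pow₀ hL1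
  have hcard1 : (1 : ℝ) ≤ Fintype.card (Edge 3 L) := by
    have : 0 < Fintype.card (Edge 3 L) := Fintype.card_pos_iff.mpr ⟨((fun _ => 0), 0)⟩
    exact_mod_cast this
  filter_upwards [radii_recordDelta1 hR'small, core_lt_recordDelta1 (L := L) hs hs5, hγ', hσ', hT', hST, hP,
    hκ'.eventually (ge_mem_nhds (show (0 : ℝ) < ε₁ / 4 by linarith only [hε₁])), hκN.eventually (ge_mem_nhds hε₁),
    eventually_ge_atTop (max B₀ 2), hσ, hdisj] with β hrad hcore hγβ hσβ hTβ hSTβ hPβ hκ'β hκNβ hβ hS hdisjβ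
  have hβ2 : 2 ≤ β := (le_max_right _ _).trans hβ
  have hβ0 : 0 ≤ β := by linarith only [hβ2]
  -- the slow scale `B = L³β ≥ max(B₀, 2)`
  have hBβ : β ≤ (L : ℝ) ^ 3 * β := le_mul_of_one_le_left hβ0 hL3
  have hB : B₀ ≤ (L : ℝ) ^ 3 * β := ((le_max_left _ _).trans hβ).trans hBβ
  have hB2 : 2 ≤ (L : ℝ) ^ 3 * β := hβ2.trans hBβ
  have hB1 : 1 ≤ (L : ℝ) ^ 3 * β := by linarith only [hB2]
  obtain ⟨φ, hφm, ⟨Cφ, hCφ⟩, hφg, hφsupp, hl2, hQ⟩ := hB₀ ((L : ℝ) ^ 3 * β) hB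
  have hφδ : ∀ u, φ u ≠ 0 → orbitDist u < recordDelta1 L s β := fun u hu => (hφsupp u hu).trans hcore
  -- positivity of the top value
  have hΛ : 0 < levelValue su2Rep 1 ((L : ℝ) ^ 3 * β) 0 :=
    lt_of_lt_of_le (mul_pos (uniformFloorConst_pos (L := 1)) (latCE_pos (L := 1) (by linarith only [hB1])))
      (levelValue_zero_ge_uniform (L := 1) hB1)
  -- the radii
  have hr := hR' β
  have hδ₁0 : 0 < recordDelta1 L s β := by
    unfold recordDelta1; exact div_pos (mul_pos (by norm_num) (powScale_pos s β)) card_site_pos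
  have hpos : 0 ≤ 4 * R' β + recordDelta1 L s β := by linarith only [hr.1, hδ₁0]
  have hρ : 4 * R' β + recordDelta1 L s β < M * (43 * powScale s β) :=
    lt_of_le_of_lt (le_mul_of_one_le_left hpos hcard1) (hrad.trans_le (le_mul_of_one_le_left (mul_pos (by norm_num) (powScale_pos s β)).le hM))
  -- the test state `v = boFun φ Ω'_β`
  obtain ⟨hwm, hwb, hw0, -⟩ := softWeight_recordChi_props (L := L) s 43 M β
  have hvm : Measurable (boFun L φ (Ω' β)) := measurable_boFun L hφm (hΩ'm β)
  have hvb : ∀ U, |boFun L φ (Ω' β) U| ≤ Cφ * 1 := abs_boFun_le L hCφ (hΩ'1 β)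
  have hvsupp : ∀ U, boFun L φ (Ω' β) U ≠ 0 → recordChi L s 43 M β U ≠ 0 := fun U hU =>
    (boFun_support_record (δ' := fun β => 43 * powScale s β) (ρ := fun b => M * (43 * powScale s b)) (δg := powScale 1)
      hφδ hr.2 (hΩ'r β) hρ hrad hU).1
  have horth : ∀ u, fibreInner L (softWeight (recordChi L s 43 M β)) (Ω β) (boFun L φ (Ω' β)) u = 0 :=
    fun u => fibreInner_boFun_eq_zero_of_disjoint _ hdisjβ φ u
  have hSTv := hSTβ _ hvm ⟨_, hvb⟩ hvsupp horth
  have hTφ := hTβ φ hφm ⟨Cφ, hCφ⟩ hφg hφδ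
  -- the norm of the test state
  have hG : ∀ u, φ u ≠ 0 → fibreMass L (softWeight (recordChi L s 43 M β)) (Ω' β) u ≤ (1 + C * (43 * powScale s β) ^ 2) * recordGamma L Ω' β := by
    intro u hu
    have h := fibreMass_recordChi_le hPβ (hΩ'm β) (hΩ'1 β) (hΩ'r β) hr.2 hρ hrad (hφδ u hu).le
    refine h.trans_eq ?_
    unfold recordGamma boGamma; ring
  have hN := tubeNormSq_boFun_le hφm hCφ (hΩ'm β) (hΩ'1 β) hwm hwb hw0 hG
  -- the exponential slack
  have hlam := bareLambda_pos_le_one hB2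
  have he : 1 - ε₁ / 2 ≤ Real.exp (-(ε₁ / 2 * bareLambda ((L : ℝ) ^ 3 * β))) := by
    have h1 := Real.add_one_le_exp (-(ε₁ / 2 * bareLambda ((L : ℝ) ^ 3 * β)))
    have h2 := mul_le_of_le_one_right hε2 hlam.2
    linarith only [h1, h2]
  -- endgame
  have hmain := slow_ratio_le hσβ.le hS hγβ hΛ hl2 (hκ'β.trans hε4) hθ₀ hQ hTφ hSTv hN
  have hclean := slow_ratio_clean hσβ.le hS hθ₀ hε₁1 hκ'β he hκNβ hmain
  have h1 : (1 - ε) * σ' β ≤ (1 - ε₁) * σ' β := mul_le_mul_of_nonneg_right (by linarith only [hε₁ε]) hσβ.le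
  have h2 : (1 - θ₀) * (1 + ε₁) * σ β ≤ (1 - θ₀) * (1 + ε) * σ β :=
    mul_le_mul_of_nonneg_right (mul_le_mul_of_nonneg_left (by linarith only [hε₁ε]) (by linarith only [hθ₀])) hS
  exact h1.trans (hclean.trans h2)

/-! ## §2 Competitor forms -/

/-- ★★ **(B-ST)`(Ω, σ)` IS FALSE GIVEN A COMPETITOR WITH `σ ≤ D·σ'`, `(1 − θ₀)D < 1`.** [cite: Luscher1983, §3] [cite: SjostrandZworski2007, §2] -/
theorem stiffGap_false_of_competitor (hL : Nonempty (NzSite L)) {s : ℝ} (hs : 0 < s) (hs5 : s < 1 / 5)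
    {Ω : ℝ → LinkSpace L → ℝ} {σ : ℝ → ℝ} (hσ : ∀ᶠ β in atTop, 0 ≤ σ β) {Ω' : ℝ → LinkSpace L → ℝ} {R' σ' κ' : ℝ → ℝ}
    (hΩ'm : ∀ β, Measurable (Ω' β)) (hΩ'1 : ∀ β x, |Ω' β x| ≤ 1) (hΩ'r : ∀ β x, Ω' β x ≠ 0 → ‖x‖ ≤ R' β)
    (hR' : ∀ β, 0 ≤ R' β ∧ R' β ≤ 1 / 2) (hR'small : ∀ᶠ β in atTop, 12 * Fintype.card (Site 3 L) * R' β < powScale s β)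
    (hdisj : ∀ᶠ β in atTop, ∀ x, Ω' β x ≠ 0 → Ω β x = 0)
    (hγ' : ∀ᶠ β in atTop, 0 < recordGamma L Ω' β) (hσ' : ∀ᶠ β in atTop, 0 < σ' β) (hκ' : Tendsto κ' atTop (𝓝 0))
    (hT' : ∀ᶠ β in atTop, ∀ φ : GaugeConfig 3 1 SU2 → ℝ, Measurable φ → (∃ C : ℝ, ∀ u, |φ u| ≤ C) →
      (∀ (g : Site 3 1 → SU2) (u : GaugeConfig 3 1 SU2), φ (gaugeTransform g u) = φ u) → (∀ u, φ u ≠ 0 → orbitDist u < recordDelta1 L s β) →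
      σ' β * recordGamma L Ω' β * qform su2Rep ((L : ℝ) ^ 3 * β) φ φ
        - κ' β * (σ' β * recordGamma L Ω' β) * (qform su2Rep ((L : ℝ) ^ 3 * β) φ φ + levelValue su2Rep 1 ((L : ℝ) ^ 3 * β) 0 * l2 φ φ)
        ≤ tubeForm β (boFun L φ (Ω' β)))
    {D : ℝ} (hdom : ∀ᶠ β in atTop, σ β ≤ D * σ' β)
    {M : ℝ} (hM : 1 ≤ M) {θ₀ : ℝ} (hθ₀ : θ₀ ≤ 1) (hD : (1 - θ₀) * D < 1) :
    ¬ (∀ᶠ β in atTop, ∀ v : GaugeConfig 3 L SU2 → ℝ, Measurable v → (∃ C : ℝ, ∀ U, |v U| ≤ C) → (∀ U, v U ≠ 0 → recordChi L s 43 M β U ≠ 0) →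
      (∀ u, fibreInner L (softWeight (recordChi L s 43 M β)) (Ω β) v u = 0) →
      tubeForm β v ≤ (1 - θ₀) * (σ β * levelValue su2Rep 1 ((L : ℝ) ^ 3 * β) 0) * tubeNormSq (softWeight (recordChi L s 43 M β)) v) := by
  intro hST
  have hε : 0 < (1 - (1 - θ₀) * D) / 4 := by linarith
  have hev := profile_dominates_of_stiff_gap hL hs hs5 hσ hΩ'm hΩ'1 hΩ'r hR' hR'small hdisj hγ' hσ' hκ' hT' hM hθ₀ hST _ hε
  obtain ⟨β, h, hdomβ, hσβ⟩ := (hev.and (hdom.and hσ')).exists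
  exact no_gap_of_dominance hσβ hθ₀ hD hdomβ h

/-- ★★ **A CERTIFIED COMPETITOR EVENTUALLY DISJOINT FROM `Ω` WITH `σ' ≥ σ` REFUTES (B-ST)`(Ω, σ, θ₀, M)` FOR EVERY `θ₀ ∈ (0,1]`, `M ≥ 1`.**
[cite: Luscher1983, §3] [cite: SjostrandZworski2007, §2] -/
theorem stiffGap_false_of_dominant_competitor (hL : Nonempty (NzSite L)) {s : ℝ} (hs : 0 < s) (hs5 : s < 1 / 5)
    {Ω : ℝ → LinkSpace L → ℝ} {σ : ℝ → ℝ} (hσ : ∀ᶠ β in atTop, 0 ≤ σ β) {Ω' : ℝ → LinkSpace L → ℝ} {R' σ' κ' : ℝ → ℝ}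
    (hΩ'm : ∀ β, Measurable (Ω' β)) (hΩ'1 : ∀ β x, |Ω' β x| ≤ 1) (hΩ'r : ∀ β x, Ω' β x ≠ 0 → ‖x‖ ≤ R' β)
    (hR' : ∀ β, 0 ≤ R' β ∧ R' β ≤ 1 / 2) (hR'small : ∀ᶠ β in atTop, 12 * Fintype.card (Site 3 L) * R' β < powScale s β)
    (hdisj : ∀ᶠ β in atTop, ∀ x, Ω' β x ≠ 0 → Ω β x = 0)
    (hγ' : ∀ᶠ β in atTop, 0 < recordGamma L Ω' β) (hσ' : ∀ᶠ β in atTop, 0 < σ' β) (hκ' : Tendsto κ' atTop (𝓝 0))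
    (hT' : ∀ᶠ β in atTop, ∀ φ : GaugeConfig 3 1 SU2 → ℝ, Measurable φ → (∃ C : ℝ, ∀ u, |φ u| ≤ C) →
      (∀ (g : Site 3 1 → SU2) (u : GaugeConfig 3 1 SU2), φ (gaugeTransform g u) = φ u) → (∀ u, φ u ≠ 0 → orbitDist u < recordDelta1 L s β) →
      σ' β * recordGamma L Ω' β * qform su2Rep ((L : ℝ) ^ 3 * β) φ φ
        - κ' β * (σ' β * recordGamma L Ω' β) * (qform su2Rep ((L : ℝ) ^ 3 * β) φ φ + levelValue su2Rep 1 ((L : ℝ) ^ 3 * β) 0 * l2 φ φ)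
        ≤ tubeForm β (boFun L φ (Ω' β)))
    (hdom : ∀ᶠ β in atTop, σ β ≤ σ' β)
    {M : ℝ} (hM : 1 ≤ M) {θ₀ : ℝ} (hθ₀ : 0 < θ₀ ∧ θ₀ ≤ 1) :
    ¬ (∀ᶠ β in atTop, ∀ v : GaugeConfig 3 L SU2 → ℝ, Measurable v → (∃ C : ℝ, ∀ U, |v U| ≤ C) → (∀ U, v U ≠ 0 → recordChi L s 43 M β U ≠ 0) →
      (∀ u, fibreInner L (softWeight (recordChi L s 43 M β)) (Ω β) v u = 0) →
      tubeForm β v ≤ (1 - θ₀) * (σ β * levelValue su2Rep 1 ((L : ℝ) ^ 3 * β) 0) * tubeNormSq (softWeight (recordChi L s 43 M β)) v) :=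
  stiffGap_false_of_competitor hL hs hs5 hσ hΩ'm hΩ'1 hΩ'r hR' hR'small hdisj hγ' hσ' hκ' hT' (D := 1)
    (by filter_upwards [hdom] with β h; linarith) hM hθ₀.2 (by linarith [hθ₀.1])

/-! ## §3 ★★★ The certificate discharged by lane A's schedule-B (B-T): admissible competitors -/

/-- ★★★ **AN ADMISSIBLE COMPETITOR WITH `σ_B ≥ σ` REFUTES (B-ST)`(Ω, σ)`.**  `L` with a nonzero site, `0 < s < 1/5`, `σ ≥ 0` eventually.  Let `Ω'` be admissible in the
sense of `…BTProfileRecord.profileB_hT` — measurable, `0 ≤ Ω' ≤ 1`, colour blind, supported in `‖x‖ ≤ r' β` with `0 < r' ≤ 1/40`, `r' ≤ β^{-1/2}ℓ`, `recordGamma L Ω' β > 0`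
for all `β` — with `∫Ω' dπ > 0` eventually, eventually disjoint from `Ω`, and with `σ β ≤ σ_B(Ω') β` eventually.  Then (B-ST)`(Ω, σ, θ₀, M)` fails for every `θ₀ ∈ (0,1]` and
every `M ≥ 1`: the competitor's one-sided certificate is the lower half of `profileB_hT`. [cite: Luscher1983, §3] [cite: SjostrandZworski2007, §2] -/
theorem stiffGap_false_of_admissible_competitor (hL : Nonempty (NzSite L)) {s : ℝ} (hs : 0 < s) (hs5 : s < 1 / 5)
    {Ω : ℝ → LinkSpace L → ℝ} {σ : ℝ → ℝ} (hσ : ∀ᶠ β in atTop, 0 ≤ σ β)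
    {Ω' : ℝ → LinkSpace L → ℝ} (hΩ'm : ∀ β, Measurable (Ω' β)) (hΩ'1 : ∀ β x, |Ω' β x| ≤ 1) (hΩ'0 : ∀ β x, 0 ≤ Ω' β x)
    (hΩ'inv : ∀ β (g : SU2) (x : LinkSpace L), Ω' β (adL L g x) = Ω' β x) {r' : ℝ → ℝ}
    (hr' : ∀ β, 0 < r' β ∧ r' β ≤ 1 / 40 ∧ r' β ≤ powScale (1 / 2) β * btLog β) (hΩ'r : ∀ β x, Ω' β x ≠ 0 → ‖x‖ ≤ r' β)
    (hγ' : ∀ β, 0 < recordGamma L Ω' β) (hI' : ∀ᶠ β in atTop, 0 < ∫ v, Ω' β (linkEmbed L v) ∂orthoTransverse L)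
    (hdisj : ∀ᶠ β in atTop, ∀ x, Ω' β x ≠ 0 → Ω β x = 0)
    (hdom : ∀ᶠ β in atTop, σ β ≤ btC L β (Ω' β) (btEps β) (5 * (powScale (1 / 2) β * btLog β ^ 2)) / fpZ (btEps β) / recordGamma L Ω' β)
    {M : ℝ} (hM : 1 ≤ M) {θ₀ : ℝ} (hθ₀ : 0 < θ₀ ∧ θ₀ ≤ 1) :
    ¬ (∀ᶠ β in atTop, ∀ v : GaugeConfig 3 L SU2 → ℝ, Measurable v → (∃ C : ℝ, ∀ U, |v U| ≤ C) → (∀ U, v U ≠ 0 → recordChi L s 43 M β U ≠ 0) →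
      (∀ u, fibreInner L (softWeight (recordChi L s 43 M β)) (Ω β) v u = 0) →
      tubeForm β v ≤ (1 - θ₀) * (σ β * levelValue su2Rep 1 ((L : ℝ) ^ 3 * β) 0) * tubeNormSq (softWeight (recordChi L s 43 M β)) v) := by
  have hs4 : s ≤ 1 / 4 := by linarith
  have hs2 : s < 1 / 2 := by linarith
  have hr'' : ∀ β, 0 ≤ r' β ∧ r' β ≤ powScale (1 / 2) β * btLog β := fun β => ⟨(hr' β).1.le, (hr' β).2.2⟩
  have hΩ't : ∀ β (v : Edge 3 L → Fin 3 → ℝ), Ω' β (linkEmbed L v) ≠ 0 → (∀ (e : Edge 3 L) (c : Fin 3), |v e c| ≤ r' β) ∧ ‖linkEmbed L v‖ ≤ r' β := by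
    intro β v hv
    have h := hΩ'r β _ hv
    exact ⟨fun e c => by have := abs_apply_le_norm (linkEmbed L v) e c; rw [linkEmbed_apply] at this; exact this.trans h, h⟩
  -- the competitor's data in the currency of §1
  set σ' : ℝ → ℝ := fun β => btC L β (Ω' β) (btEps β) (5 * (powScale (1 / 2) β * btLog β ^ 2)) / fpZ (btEps β) / recordGamma L Ω' β with hσ'def
  set κ' : ℝ → ℝ := fun β => 2 * (powScale (2 * s) β * btLog β ^ 9) with hκ'def
  have hκ' : Tendsto κ' atTop (𝓝 0) := by
    have := (tendsto_powScale_mul_btLog_pow (show (0 : ℝ) < 2 * s by linarith) 9).const_mul 2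
    simpa [hκ'def] using this
  have hρR : ∀ᶠ β : ℝ in atTop, 2 * (btEps β / 3) < 5 * (powScale (1 / 2) β * btLog β ^ 2) := Eventually.of_forall fun β => by
    have hεx : btEps β ≤ powScale (1 / 2) β := powScale_le_powScale (by norm_num) β
    have hx0 := powScale_pos (1 / 2) β
    have h1 : powScale (1 / 2) β * 1 ≤ powScale (1 / 2) β * btLog β ^ 2 := mul_le_mul_of_nonneg_left (one_le_pow₀ (one_le_btLog β)) hx0.le
    linarith
  have hσ'pos : ∀ᶠ β in atTop, 0 < σ' β := by
    filter_upwards [eventually_ge_atTop (0 : ℝ), hI', hρR] with β hβ hI hρ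
    exact div_pos (div_pos (btC_profile_pos hβ (hΩ'm β) (hΩ'1 β) (hΩ'0 β) (by linarith [(hr' β).2.1]) (hΩ't β) hI hρ) (fpZ_pos (btEps_pos_le β).1)) (hγ' β)
  have hT2 := profileB_hT (L := L) hs hs4 hΩ'm hΩ'1 hΩ'0 hΩ'inv hr' hΩ't hγ'
  have hT' : ∀ᶠ β in atTop, ∀ φ : GaugeConfig 3 1 SU2 → ℝ, Measurable φ → (∃ C : ℝ, ∀ u, |φ u| ≤ C) →
      (∀ (g : Site 3 1 → SU2) (u : GaugeConfig 3 1 SU2), φ (gaugeTransform g u) = φ u) → (∀ u, φ u ≠ 0 → orbitDist u < recordDelta1 L s β) →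
      σ' β * recordGamma L Ω' β * qform su2Rep ((L : ℝ) ^ 3 * β) φ φ
        - κ' β * (σ' β * recordGamma L Ω' β) * (qform su2Rep ((L : ℝ) ^ 3 * β) φ φ + levelValue su2Rep 1 ((L : ℝ) ^ 3 * β) 0 * l2 φ φ)
        ≤ tubeForm β (boFun L φ (Ω' β)) := by
    filter_upwards [hT2] with β h φ hφm hφb hφg hφδ
    have := (abs_le.mp (h φ hφm hφb hφg hφδ)).1
    simp only [hσ'def, hκ'def]
    linarith
  exact stiffGap_false_of_dominant_competitor hL hs hs5 hσ hΩ'm hΩ'1 hΩ'r (fun β => ⟨(hr' β).1.le, by linarith [(hr' β).2.1]⟩)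
    (eventually_radius_small_B hs2 hr'') hdisj (Eventually.of_forall hγ') hσ'pos hκ' hT' hdom hM hθ₀

/-! ## §4 The two packagings of record -/

/-- ★★★ **`hST` OF `…BTRecord.recordAnalyticInput_of_stiff_offDiag` (`Ω = btOmega`, `σ = btSlow`) IS FALSE AS SOON AS ONE ADMISSIBLE PROFILE EVENTUALLY DISJOINT FROM THE
BALL `‖x‖ ≤ btRad β` HAS `σ_B ≥ btSlow` EVENTUALLY** — for every `θ₀ ∈ (0,1]` and every fat factor `M ≥ 1` (`0 < s < 1/5`).  The free room is the annulus
`β^{-1/2} < ‖x‖ ≤ β^{-1/2}·btLog β`. [cite: Luscher1983, §3] [cite: SjostrandZworski2007, §2] -/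
theorem btStiffGap_false_of_admissible_competitor (hL : Nonempty (NzSite L)) {s : ℝ} (hs : 0 < s) (hs5 : s < 1 / 5)
    {Ω' : ℝ → LinkSpace L → ℝ} (hΩ'm : ∀ β, Measurable (Ω' β)) (hΩ'1 : ∀ β x, |Ω' β x| ≤ 1) (hΩ'0 : ∀ β x, 0 ≤ Ω' β x)
    (hΩ'inv : ∀ β (g : SU2) (x : LinkSpace L), Ω' β (adL L g x) = Ω' β x) {r' : ℝ → ℝ}
    (hr' : ∀ β, 0 < r' β ∧ r' β ≤ 1 / 40 ∧ r' β ≤ powScale (1 / 2) β * btLog β) (hΩ'r : ∀ β x, Ω' β x ≠ 0 → ‖x‖ ≤ r' β)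
    (hγ' : ∀ β, 0 < recordGamma L Ω' β) (hI' : ∀ᶠ β in atTop, 0 < ∫ v, Ω' β (linkEmbed L v) ∂orthoTransverse L)
    (hdisj : ∀ᶠ β in atTop, ∀ x, Ω' β x ≠ 0 → btOmega L β x = 0)
    (hdom : ∀ᶠ β in atTop, btSlow L β ≤ btC L β (Ω' β) (btEps β) (5 * (powScale (1 / 2) β * btLog β ^ 2)) / fpZ (btEps β) / recordGamma L Ω' β)
    {M : ℝ} (hM : 1 ≤ M) {θ₀ : ℝ} (hθ₀ : 0 < θ₀ ∧ θ₀ ≤ 1) :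
    ¬ (∀ᶠ β in atTop, ∀ v : GaugeConfig 3 L SU2 → ℝ, Measurable v → (∃ C : ℝ, ∀ U, |v U| ≤ C) → (∀ U, v U ≠ 0 → recordChi L s 43 M β U ≠ 0) →
      (∀ u, fibreInner L (softWeight (recordChi L s 43 M β)) (btOmega L β) v u = 0) →
      tubeForm β v ≤ (1 - θ₀) * (btSlow L β * levelValue su2Rep 1 ((L : ℝ) ^ 3 * β) 0) * tubeNormSq (softWeight (recordChi L s 43 M β)) v) :=
  stiffGap_false_of_admissible_competitor hL hs hs5 ((eventually_ge_atTop (0 : ℝ)).mono fun _ hβ => (btSlow_pos hβ).le)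
    hΩ'm hΩ'1 hΩ'0 hΩ'inv hr' hΩ'r hγ' hI' hdisj hdom hM hθ₀

/-- ★★★ **`hST` OF `…BTProfileRecord.recordAnalyticInput_of_profile` (`(Ω, σ_B(Ω))`, `Ω` admissible with `∫Ω dπ > 0`) IS FALSE AS SOON AS ONE ADMISSIBLE PROFILE
EVENTUALLY DISJOINT FROM `Ω` HAS `σ_B(Ω') ≥ σ_B(Ω)` EVENTUALLY** — for every `θ₀ ∈ (0,1]`, `M ≥ 1` (`0 < s < 1/5`).  Void (no such `Ω'`) when `supp Ω β` is the whole
admissible ball, e.g. `Ω = frozenProfile L q r_B` with `q` finite. [cite: Luscher1983, §3] [cite: SjostrandZworski2007, §2] -/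
theorem profileStiffGap_false_of_admissible_competitor (hL : Nonempty (NzSite L)) {s : ℝ} (hs : 0 < s) (hs5 : s < 1 / 5)
    {Ω : ℝ → LinkSpace L → ℝ} (hΩm : ∀ β, Measurable (Ω β)) (hΩ1 : ∀ β x, |Ω β x| ≤ 1) (hΩ0 : ∀ β x, 0 ≤ Ω β x)
    (hΩr : ∀ β x, Ω β x ≠ 0 → ‖x‖ ≤ min (1 / 40) (powScale (1 / 2) β * btLog β))
    (hI : ∀ β, 0 < ∫ v, Ω β (linkEmbed L v) ∂orthoTransverse L) (hγ : ∀ β, 0 < recordGamma L Ω β)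
    {Ω' : ℝ → LinkSpace L → ℝ} (hΩ'm : ∀ β, Measurable (Ω' β)) (hΩ'1 : ∀ β x, |Ω' β x| ≤ 1) (hΩ'0 : ∀ β x, 0 ≤ Ω' β x)
    (hΩ'inv : ∀ β (g : SU2) (x : LinkSpace L), Ω' β (adL L g x) = Ω' β x) {r' : ℝ → ℝ}
    (hr' : ∀ β, 0 < r' β ∧ r' β ≤ 1 / 40 ∧ r' β ≤ powScale (1 / 2) β * btLog β) (hΩ'r : ∀ β x, Ω' β x ≠ 0 → ‖x‖ ≤ r' β)
    (hγ' : ∀ β, 0 < recordGamma L Ω' β) (hI' : ∀ᶠ β in atTop, 0 < ∫ v, Ω' β (linkEmbed L v) ∂orthoTransverse L)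
    (hdisj : ∀ᶠ β in atTop, ∀ x, Ω' β x ≠ 0 → Ω β x = 0)
    (hdom : ∀ᶠ β in atTop, btC L β (Ω β) (btEps β) (5 * (powScale (1 / 2) β * btLog β ^ 2)) / fpZ (btEps β) / recordGamma L Ω β ≤
      btC L β (Ω' β) (btEps β) (5 * (powScale (1 / 2) β * btLog β ^ 2)) / fpZ (btEps β) / recordGamma L Ω' β)
    {M : ℝ} (hM : 1 ≤ M) {θ₀ : ℝ} (hθ₀ : 0 < θ₀ ∧ θ₀ ≤ 1) :
    ¬ (∀ᶠ β in atTop, ∀ v : GaugeConfig 3 L SU2 → ℝ, Measurable v → (∃ C : ℝ, ∀ U, |v U| ≤ C) → (∀ U, v U ≠ 0 → recordChi L s 43 M β U ≠ 0) →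
      (∀ u, fibreInner L (softWeight (recordChi L s 43 M β)) (Ω β) v u = 0) →
      tubeForm β v ≤ (1 - θ₀) * ((btC L β (Ω β) (btEps β) (5 * (powScale (1 / 2) β * btLog β ^ 2)) / fpZ (btEps β) / recordGamma L Ω β) *
        levelValue su2Rep 1 ((L : ℝ) ^ 3 * β) 0) * tubeNormSq (softWeight (recordChi L s 43 M β)) v) := by
  have hΩt : ∀ β (v : Edge 3 L → Fin 3 → ℝ), Ω β (linkEmbed L v) ≠ 0 →
      (∀ (e : Edge 3 L) (c : Fin 3), |v e c| ≤ min (1 / 40) (powScale (1 / 2) β * btLog β)) ∧ ‖linkEmbed L v‖ ≤ min (1 / 40) (powScale (1 / 2) β * btLog β) := by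
    intro β v hv
    have h := hΩr β _ hv
    exact ⟨fun e c => by have := abs_apply_le_norm (linkEmbed L v) e c; rw [linkEmbed_apply] at this; exact this.trans h, h⟩
  have hσ : ∀ᶠ β : ℝ in atTop, 0 ≤ btC L β (Ω β) (btEps β) (5 * (powScale (1 / 2) β * btLog β ^ 2)) / fpZ (btEps β) / recordGamma L Ω β := by
    filter_upwards [eventually_ge_atTop (0 : ℝ)] with β hβ
    have hρR : 2 * (btEps β / 3) < 5 * (powScale (1 / 2) β * btLog β ^ 2) := by
      have hεx : btEps β ≤ powScale (1 / 2) β := powScale_le_powScale (by norm_num) β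
      have hx0 := powScale_pos (1 / 2) β
      have h1 : powScale (1 / 2) β * 1 ≤ powScale (1 / 2) β * btLog β ^ 2 := mul_le_mul_of_nonneg_left (one_le_pow₀ (one_le_btLog β)) hx0.le
      linarith
    exact (div_pos (div_pos (btC_profile_pos hβ (hΩm β) (hΩ1 β) (hΩ0 β) (by linarith [min_le_left (1 / 40 : ℝ) (powScale (1 / 2) β * btLog β)]) (hΩt β)
      (hI β) hρR) (fpZ_pos (btEps_pos_le β).1)) (hγ β)).le
  exact stiffGap_false_of_admissible_competitor hL hs hs5 hσ hΩ'm hΩ'1 hΩ'0 hΩ'inv hr' hΩ'r hγ' hI' hdisj hdom hM hθ₀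

end Summit.QuantumFields.YangMills.Theorems.TwistedTraceScaling.Negative.R42

end
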